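import Mathlib
import Summits.KontsevichZagierPeriods.KontsevichZagierPeriods.Theses.Grothendieck
import Literature.NumberTheory.Transcendental.KZCubicalCalculus
import Literature.NumberTheory.Transcendental.AyoubPeriodSeries

/-!
# Sketch — crux-ideate round 1 (ideator k = 1) for `Grothendieck.SectorComplement`
(item stmt-KontsevichZagierPeriods-11102).

First lemmas of the three crux idea cards, stated over existing declarations (they need not be
proved here; they must elaborate). One of them (`amalgamation_cleared`) is proved, to show the
amalgamation lever is real algebra and not a slogan.

* card `barriers-as-conditionals`: `legendrePoly`, `PrincipalSqueezeCore`.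
* card `ayoub-cube-bridge`: `DummyVariableMove`, `StokesSpanTransfer`, `AyoubKernelConjecture`.
* card `sector-amalgamation`: `KernelQ`, `amalgamation_cleared` (proved), `AmalgamationQ`.
-/

noncomputable section

open MvPolynomial

namespace Summit.KontsevichZagierPeriods.KontsevichZagierPeriods.Cruxes.SectorComplement.SketchIdeator1

open Literature.NumberTheory.Transcendental

/-! ### Card 1 — barriers-as-conditionals: the principal squeeze core -/

/-- Legendre's relation as a polynomial in `x₀ = K, x₁ = E, x₂ = K′, x₃ = E′, x₄ = π`:
`K E′ + E K′ − K K′ − π/2`. -/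
def legendrePoly : MvPolynomial (Fin 5) ℚ :=
  X 0 * X 3 + X 1 * X 2 - X 0 * X 2 - C (1 / 2 : ℚ) * X 4

/-- PRINCIPAL SQUEEZE CORE (pure algebra, provable now): if `K, E, K′, E′` are algebraically
independent over `ℚ` and `π := 2 (K E′ + E K′ − K K′)`, then the ideal of ALL `ℚ`-polynomial
relations among `(K, E, K′, E′, π)` is the principal ideal generated by Legendre's polynomial —
because `ℚ[x₀..x₄]/(L) ≅ ℚ[x₀..x₃] ↪ ℝ`. No primality / Gröbner computation is needed: the
relation ideal is a height-one prime in a UFD. This is the transcendence-to-ideal step of the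
conditional elliptic-family count (hypothesis = the typed open statement
`Literature.Barriers.KontsevichZagierPeriods.EllipticPeriodsAlgIndep` at a non-CM modulus). -/
def PrincipalSqueezeCore : Prop :=
  ∀ v : Fin 4 → ℝ, AlgebraicIndependent ℚ v →
    RingHom.ker (MvPolynomial.aeval (R := ℚ)
        (Fin.snoc v (2 * (v 0 * v 3 + v 1 * v 2 - v 0 * v 2)) : Fin 5 → ℝ))
      = Ideal.span {legendrePoly}

/-! ### Card 2 — ayoub-cube-bridge -/

/-- DUMMY-VARIABLE MOVE (provable now by ONE `newtonLeibnizRel` instance with primitive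
`F z = z (Fin.last n) * r.integrand (Fin.init z)`, `a = 0`, `b = 1`): a cube representation is
KZ-equivalent to its pull-back to the cube of one more dimension. This realises, inside the H21
calculus, the transition maps of Ayoub's direct limit `𝒪_alg(𝔻̄^n) → 𝒪_alg(𝔻̄^{n+1})`. -/
def DummyVariableMove : Prop :=
  ∀ (n : ℕ) (r : KZ.IntegralRep n) (r' : KZ.IntegralRep (n + 1)),
    r.domain = KZ.cube n → r'.domain = KZ.cube (n + 1) →
    (∀ z ∈ r'.domain, r'.integrand z = r.integrand (Fin.init z)) → KZ.Equivalent r' r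

/-- STOKES-SPAN TRANSFER (the bridge lemma, provable from the PROVED cubical generators
`KZ.cubicalLinGens/StokesGens/CovGens ⊆ KZ.relations` plus `DummyVariableMove` and coordinate
swaps): a `ℤ`-combination of tame-cube representations in a common dimension `N` whose integrand
is, as a FUNCTION on the cube, a finite sum of Stokes elements
`∂_{i_k} g_k − g_k|_{z_{i_k}=1} + g_k|_{z_{i_k}=0}` (`g_k` analytic and `ℚ`-semialgebraic near the cube;
real-algebraic scalar coefficients are absorbed into the `g_k`) is a KZ relation. -/
def StokesSpanTransfer : Prop :=
  ∀ (N : ℕ) (ι κ : Type) [Fintype ι] [Fintype κ] (c : ι → ℤ) (s : ι → KZ.IntegralRep N)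
    (g : κ → (Fin N → ℝ) → ℝ) (i : κ → Fin N) (U : Set (Fin N → ℝ)),
    IsOpen U → KZ.cube N ⊆ U →
    (∀ j, (s j).IsTameCube) →
    (∀ k, AnalyticOnNhd ℝ (g k) U ∧ IsSemialgebraicFunOn ℚ U (g k)) →
    (∀ z ∈ KZ.cube N, ∑ j, (c j : ℝ) * (s j).integrand z =
        ∑ k, (fderiv ℝ (g k) z (Pi.single (i k) 1)
              - g k (Function.update z (i k) 1) + g k (Function.update z (i k) 0))) →
    ∑ j, c j • KZ.of (s j) ∈ KZ.relations

/-- AYOUB'S KERNEL CONJECTURE, typed verbatim over the tree's `AyoubRel.Oan`, `intC`, `relAC`,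
`kSpan` (Ayoub 2015 Conj. 1.1 for `k = ℚ`; `= ` Fresán 2024 Conj. 3.5): the kernel of
`∫_{[0,1]^∞}` on `𝒪_{ℚ-alg}(𝔻̄^∞)` is the `ℚ`-span of the Stokes elements. OPEN (it implies the
Kontsevich–Zagier conjecture in print: Ayoub 2015 Fait 1.4); this is the conjecture leaf of the
bridge, NOT a claim. -/
def AyoubKernelConjecture : Prop :=
  ∀ F ∈ AyoubRel.Oan (algebraMap ℚ ℂ), AyoubRel.intC F = 0 →
    F ∈ AyoubRel.kSpan (algebraMap ℚ ℂ)
      {G : AyoubRel.CSeries | ∃ (i : ℕ) (H : AyoubRel.CSeries),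
          H ∈ AyoubRel.Oan (algebraMap ℚ ℂ) ∧ G = AyoubRel.relAC i H}

/-! ### Card 3 — sector-amalgamation -/

/-- Conjecture 1 in kernel form UP TO TORSION on a subgroup `G` of formal combinations (the
`ℚ`-form; torsion is removed by `CoactionDevissage.TorsionFree`, item 3169). -/
def KernelQ (G : AddSubgroup KZ.FormalRep) : Prop :=
  ∀ c ∈ G, KZ.eval c = 0 → ∃ N : ℤ, N ≠ 0 ∧ N • c ∈ KZ.relations

/-- AMALGAMATION LEMMA (cleared-denominator form), PROVED: two sector kernels glue along a common
sub-sector `C` as soon as every cross value `eval a = −eval b` (`a ∈ A`, `b ∈ B`) is, up to an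
integer multiple, the value of an element of `C`. The cross-sector content of Conjecture 1 is thus
a pure DISJOINTNESS-OF-VALUES statement. -/
theorem amalgamation_cleared (A B C : AddSubgroup KZ.FormalRep) (hCA : C ≤ A) (hCB : C ≤ B)
    (hA : KernelQ A) (hB : KernelQ B)
    (hV : ∀ a ∈ A, ∀ b ∈ B, KZ.eval a + KZ.eval b = 0 →
      ∃ M : ℤ, M ≠ 0 ∧ ∃ γ ∈ C, (M : ℝ) * KZ.eval a = KZ.eval γ) :
    KernelQ (A ⊔ B) := by
  intro c hc h0
  obtain ⟨a, ha, b, hb, rfl⟩ := AddSubgroup.mem_sup.mp hc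
  rw [map_add] at h0
  obtain ⟨M, hM, γ, hγ, hMγ⟩ := hV a ha b hb h0
  have h1mem : M • a - γ ∈ A := A.sub_mem (A.zsmul_mem ha M) (hCA hγ)
  have h1val : KZ.eval (M • a - γ) = 0 := by
    rw [map_sub, map_zsmul, zsmul_eq_mul]
    linear_combination hMγ
  have h2mem : M • b + γ ∈ B := B.add_mem (B.zsmul_mem hb M) (hCB hγ)
  have h2val : KZ.eval (M • b + γ) = 0 := by
    rw [map_add, map_zsmul, zsmul_eq_mul]
    linear_combination (M : ℝ) * h0 - hMγ
  obtain ⟨N₁, hN₁, hr₁⟩ := hA _ h1mem h1val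
  obtain ⟨N₂, hN₂, hr₂⟩ := hB _ h2mem h2val
  refine ⟨N₁ * N₂ * M, mul_ne_zero (mul_ne_zero hN₁ hN₂) hM, ?_⟩
  have key : (N₁ * N₂ * M) • (a + b) = N₂ • (N₁ • (M • a - γ)) + N₁ • (N₂ • (M • b + γ)) := by
    module
  rw [key]
  exact KZ.relations.add_mem (KZ.relations.zsmul_mem hr₁ N₂) (KZ.relations.zsmul_mem hr₂ N₁)

/-- AMALGAMATION, `ℚ`-span form (the statement the card files; provable from
`amalgamation_cleared` by clearing denominators in `Submodule.span ℚ (eval '' C)`): if `C ≤ A`,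
`C ≤ B`, both sector kernels hold up to torsion, and the `ℚ`-spans of values satisfy
`V_A ∩ V_B ⊆ V_C` (linear disjointness over the backbone `C`), then the kernel holds up to torsion on
`A ⊔ B`. -/
def AmalgamationQ : Prop :=
  ∀ A B C : AddSubgroup KZ.FormalRep, C ≤ A → C ≤ B → KernelQ A → KernelQ B →
    Submodule.span ℚ (KZ.eval '' (A : Set KZ.FormalRep)) ⊓ Submodule.span ℚ (KZ.eval '' (B : Set KZ.FormalRep))
        ≤ Submodule.span ℚ (KZ.eval '' (C : Set KZ.FormalRep)) →
    KernelQ (A ⊔ B)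

/-! ### Sanity: the crux and how each card would reach it -/

/-- The crux as filed (rev 7/10). -/
example : Theses.Grothendieck.SectorComplement =
    (Theses.Grothendieck.LemniscaticSectorKernel → Theses.Grothendieck.GpcZeta4Eq4zeta31 →
      _root_.KontsevichZagierPeriods) := rfl

/-- Every card reaches the crux only THROUGH the Statement (the hypotheses are idle): -/
example (h : _root_.KontsevichZagierPeriods) : Theses.Grothendieck.SectorComplement := fun _ _ => h

end Summit.KontsevichZagierPeriods.KontsevichZagierPeriods.Cruxes.SectorComplement.SketchIdeator1
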